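/-
Width seat `ym-line-sgb-p1-w3` (seat prover-ym-line-sgb-p1-w3-g0-0), route `SteinGapBootstrap` rev 4, ASSEMBLY item `AssemblyR`
(stmt-QuantumFields-23210): the route decl, BY NAME.
-/
import Summits.QuantumFields.YangMills.Theorems.SteinGapBootstrapXiPowOfClusteringNonneg
import HarnessLib

/-!
# Route `SteinGapBootstrap` (rev 4), the repaired Assembly `AssemblyR` (stmt-QuantumFields-23210) — PROVED

NOT THE CLAY GAP: `XiPow` is an UPPER bound on the lattice mass gap of torus-limit states (RECORD-label rung leaf R2xi-G); the crux K1
`SteinBlockTransferG` (XL) is a HYPOTHESIS of this implication.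

`AssemblyR : SteinBlockTransferG → GapGivesClusteringGR → PolySmallFieldsG → AxisSymmetryG → XiPow`, where `GapGivesClusteringGR`
(stmt-QuantumFields-23209) is the crux K2 restated for `0 ≤ β` (the planner's rev-3/4 repair of the β-sign misstatement).  This is exactly the
composition `xiPow_of_clustering_nonneg` (module `SteinGapBootstrapXiPowOfClusteringNonneg`, landed p581290 in anticipation of the repair):
the quantitative xiDiv contradiction uses K2 only at `β ≥ max(β₀ˢ, β₀ᴷ, 1) ≥ 0`.

References: the route thesis (Assembly paragraph); S. Chatterjee, arXiv:1803.01950, Problem 5.1 [ChatterjeeYMProb2019].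
-/

set_option autoImplicit false

namespace Summit.QuantumFields.YangMills.Theorems.SteinGapBootstrap

/-- **The repaired Assembly `AssemblyR` of route `SteinGapBootstrap` (stmt-QuantumFields-23210), by name**:
`SteinBlockTransferG → GapGivesClusteringGR → PolySmallFieldsG → AxisSymmetryG → XiPow`, by `xiPow_of_clustering_nonneg`
(K2 is consumed only at non-negative coupling).  NOT THE CLAY GAP. -/
theorem AssemblyR_proof : Summit.QuantumFields.YangMills.Theses.SteinGapBootstrap.AssemblyR :=
  fun h₁ h₂ h₃ h₄ => xiPow_of_clustering_nonneg h₁ h₂ h₃ h₄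

end Summit.QuantumFields.YangMills.Theorems.SteinGapBootstrap
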